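import Summits.QuantumFields.BalabanUV.T4Continuum.Support.NE3RightInverseLetters
import HarnessLib

/-!
# T⁴ programme, node NE3 — REPAIR R24 (γ1): THE EXACT RIGHT INVERSE OF THE k-FOLD LINEARISED DOUBLE-BAR AVERAGE — `QbarIter L (k+1) W (covLift M W Φ) = φ`
# for the solved datum `Φ = ext((1 + K)⁻¹ res φ)`, with the ℓ-letters (sup ∕ ℓ² ∕ ℓ¹) of route Π's lift, k-FREE

Cell `pub-balaban-gaps` (YM blitz, track G2, seat `ne3`, unit `pub-balaban-gaps-ne3`; writer prover-pub-balaban-gaps-ne3-g3-0, 2026-08-22), census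
`run/shared/lean/pub/pub-balaban-gaps/ne/NE3.md` §4 R24 (γ).  THE OBSERVATION.  Route Π's exact curved right inverse `NE3SmoothRightInverseW.rightInvW` of the
PLAIN linearised average `dirIter` is `hatInvW (Φ) = covLift M W Φ + gaugeDir W (corrector)`, `Φ = extDir N ((1 + K)⁻¹ (res φ))`, `K ψ = res(QbarIter (covLift (ext ψ)) − ext ψ)`
(W5); the corrector only converts the DOUBLE-BAR average into the plain one (`dirIter_hatInvW`).  On B8's surface the chart supplier needs a right inverse of
`QbarIter` itself — and that is the FIRST summand alone: `QbarIter L (k+1) W (covLift M W Φ) = ext(ψ + Kψ) = ext(res φ) = φ` (W5's own computation `h2`∕`h3` in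
`dirIter_rightInvW`).  Its letters are the lift's letters (W6b⁰∕W6d⁰: `NE3RightInverseL2Letter.dirSq_covLift_le`, `NE3RightInverseL1Letter.dirL1_covLift_le`,
`NE3SmoothLiftBounds.norm_smoothLift_le`) composed with the solve letters (`NE3RightInverseSolveLetters.dirSq_solve_le` ∕ `dirL1_solve_le` ∕ `norm_solve_le`) —
NO frame corrector, hence NO `frameC`∕`corrC` factors.

CONTENT (0 sorry, no `def`; the object is written out as `covLift (L^{k+1}) W (extDir N (solveW … (resSkew N hφ)))`):
§1 **`QbarIter_covLift_solveW`** — EXACTNESS: for `L ≥ 2`, unitary `(L^{k+1}·N)`-periodic `W` in the multi-level small-field class with `θ = cruxC·(L^{k+1})²·x < 1`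
   and a skew `N`-periodic coarse `φ`: `QbarIter L (k+1) W (covLift (L^{k+1}) W Φ) = φ`; `covLift_solveW_skew`, `covLift_solveW_periodic` (period `N·L^{k+1}`);
§2 the ℓ-letters in the junction's currency (`M = L^{k+1}`, `θ_loc = thetaLoc·M²x < 1`): **`covLift_solveW_R5`** (sup: `≤ liftC∕(M(1−θ))·s` for `‖φ‖_∞ ≤ s`),
   **`covLift_solveW_R1`** (`dirSq ≤ (liftC∕(1−θ_loc))²·(M^d∕M²)·dirSq φ`), **`covLift_solveW_R4`** (`dirL1 ≤ (liftC∕(1−θ_loc))·(M^d∕M)·dirL1 φ`).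

WHAT REMAINS of (γ1) (honest): the curl letters (R2)(R3)(R6′) of the lift alone (the sums inside `NE3HatInvCurlLetters.curlSq_hatInvW_le` over
`NE3CovLiftCurl.norm_curl_covLift_le`, to be re-exported without the corrector), and the DIVERGENCE letter `Σ‖covDiv_W (covLift M W Φ)‖² ≲ M^{d−4}·Σ‖Φ‖²`
(longitudinal profile differences of `smoothLift`; feeds `Spine/NE3/LandauProjectionB8.sum_nhsNormSq_gaugeDir_le_of_isLandauB8`).

HONEST FRAMING.  Kinematics∕finite-dimensional linear algebra of OUR objects at one background; constants explicit and crude; nothing about minimisers; the chart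
supplier, (P♮), (RES♯), the covariant root and **NE3 are NOT proved**; spine PROVED 0∕9; finite T⁴ rung (B)+1 — NOT infinite volume, NOT mass gap, NOT `BetaPertH`,
NOT Clay.  PLACEMENT: `Summits/QuantumFields/BalabanUV/T4Continuum/Spine/NE3/`; imports accepted modules only; moves nothing.  HONEST DEPENDENCY: continuum YM
on T⁴ ⇐ BetaPertH ∧ nine spine estimates (0/9 proved); BetaPertH ⇐ (D1) ∧ (D4) ∧ CAP+tail; G-an2-4 gates asym, D1 and NE2/3/4.
-/

set_option autoImplicit false

open scoped BigOperators Matrix.Norms.L2Operator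
open Finset

namespace Summit.QuantumFields.BalabanUV.T4Continuum.NE3.QbarRightInverseB8

open Literature.MathematicalPhysics.QuantumFieldTheory.Balaban1983to89
open B7Prop1Explicit B7Prop2Explicit
open T4AveragingDeficitWall (IsUnitaryCfg IsSkewDir SmallField curl curlSq dirSq dirL1)
open T4AveragingDeficitWallBoundary (IsPeriodicCfg periodBox)
open AveragingDeficitPeriodicCounting (IsPeriodicDir)
open AveragingDeficitMultiLevelPrep (cavgIter LevelSmall tower)
open AveragingDeficitTwoLevelPrep (skewSub)
open AveragingDeficitTorusChart (TDir extDir resDir redN redN_boxVec extDir_resDir isPeriodicDir_extDir)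
open NE3TangentCovariantTower (QbarIter)
open NE3CovariantLift (covLift isSkewDir_covLift covLift_add_period_tower norm_covLift_eq)
open NE3QbarIterCovLiftPrep (cruxC liftC)
open NE3FramePotBoundW (isPeriodicDir_QbarIter tower_eq_pow_mul)
open NE3SmoothLiftBounds (norm_smoothLift_le)
open SmoothRefineBlocks (blk)
open NE3SmoothRightInverseW (solveW resSkew coe_resSkew straightDefect straightDefectSkew straightDefect_apply solveW_eq isSkewDir_extDir_solveW)
open NE3RightInverseSolveLetters (thetaLoc dirSq_solve_le dirL1_solve_le norm_solve_le)
open NE3RightInverseL2Letter (dirSq_covLift_le)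
open NE3RightInverseL1Letter (dirL1_covLift_le)

noncomputable section

variable {d : ℕ} {n : Type*} [Fintype n] [DecidableEq n]

section RightInv

variable [Nonempty n] {L : ℕ} (hL : 2 ≤ L) (k : ℕ) {N : ℕ} [NeZero N] {W : Site d → Fin d → (Matrix n n ℂ)ˣ} {x : ℝ}
  (hWu : IsUnitaryCfg W) (hWP : IsPeriodicCfg W ((tower L N (k + 1) : ℕ) : ℤ)) (hx : 0 ≤ x) (hs : LevelSmall d L k x) (hWx : SmallField W x)
  (hθ : cruxC d L * (((L : ℝ) ^ (k + 1)) ^ 2 * x) < 1) (hθl : thetaLoc d L * (((L : ℝ) ^ (k + 1)) ^ 2 * x) < 1)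
  {φ : Site d → Fin d → Matrix n n ℂ} (hφ : IsSkewDir φ) (hφP : IsPeriodicDir φ (N : ℤ))

/-! ## §1 Exactness, skewness, periodicity -/

include hWP hφP in
/-- **`QbarIter L (k+1) W (covLift M W Φ) = φ` EXACTLY** (`M = L^{k+1}`, `Φ = extDir N ((1 + K)⁻¹ (res φ))`): the covariant lift of the solved datum is a right
inverse of the k-fold linearised DOUBLE-BAR average — the first summand of route Π's `rightInvW`, before the frame corrector.  The top field is `N`-periodic
(so it is the extension of its restriction), and its restriction is `ψ + Kψ = res φ` by the solve. [folklore] -/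
theorem QbarIter_covLift_solveW :
    QbarIter L (k + 1) W (covLift (L ^ (k + 1)) W
      (extDir N ((solveW hL k hWu hx hs hWx N hθ (resSkew N hφ) : ↥(skewSub d n N)) : TDir d n N))) = φ := by
  set ψ : ↥(skewSub d n N) := solveW hL k hWu hx hs hWx N hθ (resSkew N hφ) with hψ
  set Φ : Site d → Fin d → Matrix n n ℂ := extDir N (ψ : TDir d n N) with hΦ
  have hΦP : IsPeriodicDir Φ (N : ℤ) := isPeriodicDir_extDir N _
  have hYP : IsPeriodicDir (covLift (L ^ (k + 1)) W Φ) ((tower L N (k + 1) : ℕ) : ℤ) := covLift_add_period_tower hL k hWP hΦP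
  have hQP : IsPeriodicDir (QbarIter L (k + 1) W (covLift (L ^ (k + 1)) W Φ)) (N : ℤ) := isPeriodicDir_QbarIter L N (k + 1) hWP hYP
  have h2 : QbarIter L (k + 1) W (covLift (L ^ (k + 1)) W Φ) = extDir N (resDir N (QbarIter L (k + 1) W (covLift (L ^ (k + 1)) W Φ))) :=
    (extDir_resDir N hQP).symm
  have h3 : resDir N (QbarIter L (k + 1) W (covLift (L ^ (k + 1)) W Φ))
      = ((ψ + straightDefectSkew hL k hWu hx hs hWx N ψ : ↥(skewSub d n N)) : TDir d n N) := by
    funext r κ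
    rw [Submodule.coe_add, Pi.add_apply, Pi.add_apply]
    show _ = (ψ : TDir d n N) r κ + straightDefect hL k hWu hx hs hWx N (ψ : TDir d n N) r κ
    rw [straightDefect_apply]
    simp only [resDir, hΦ]
    abel
  rw [h2, h3, solveW_eq, coe_resSkew, extDir_resDir N hφP]

/-- The lift of the solved datum is a skew direction. [folklore] -/
theorem covLift_solveW_skew :
    IsSkewDir (covLift (L ^ (k + 1)) W
      (extDir N ((solveW hL k hWu hx hs hWx N hθ (resSkew N hφ) : ↥(skewSub d n N)) : TDir d n N))) :=
  isSkewDir_covLift hWu _ (isSkewDir_extDir_solveW hL k hWu hx hs hWx N hθ (resSkew N hφ))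

include hWP in
/-- The lift of the solved datum is `(N·L^{k+1})`-periodic (the junction's spelling). [folklore] -/
theorem covLift_solveW_periodic :
    IsPeriodicDir (covLift (L ^ (k + 1)) W
      (extDir N ((solveW hL k hWu hx hs hWx N hθ (resSkew N hφ) : ↥(skewSub d n N)) : TDir d n N))) ((N * L ^ (k + 1) : ℕ) : ℤ) := by
  have h := covLift_add_period_tower hL k hWP
    (isPeriodicDir_extDir N ((solveW hL k hWu hx hs hWx N hθ (resSkew N hφ) : ↥(skewSub d n N)) : TDir d n N))
  have hT : tower L N (k + 1) = N * L ^ (k + 1) := by rw [tower_eq_pow_mul, Nat.mul_comm]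
  rwa [hT] at h

/-! ## §2 The ℓ-letters of the lift of the solved datum -/

/-- **(R5) SUP**: for `‖φ‖_∞ ≤ s`, `‖covLift M W Φ (y, μ)‖ ≤ liftC ∕ (M·(1 − θ)) · s` at every bond (`θ = cruxC·M²x`). [folklore] -/
theorem covLift_solveW_R5 (hd : 1 ≤ d) {s : ℝ} (hs0 : 0 ≤ s) (hφs : ∀ (z : Site d) (κ : Fin d), ‖φ z κ‖ ≤ s) (y : Site d) (μ : Fin d) :
    ‖covLift (L ^ (k + 1)) W (extDir N ((solveW hL k hWu hx hs hWx N hθ (resSkew N hφ) : ↥(skewSub d n N)) : TDir d n N)) y μ‖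
      ≤ liftC d / ((L : ℝ) ^ (k + 1) * (1 - cruxC d L * (((L : ℝ) ^ (k + 1)) ^ 2 * x))) * s := by
  have hM2 : 2 ≤ L ^ (k + 1) := le_trans hL (Nat.le_self_pow (by omega) L)
  have hMr : ((L ^ (k + 1) : ℕ) : ℝ) = (L : ℝ) ^ (k + 1) := by push_cast; ring
  have hpos : 0 < 1 - cruxC d L * (((L : ℝ) ^ (k + 1)) ^ 2 * x) := by linarith
  have hM0 : (0 : ℝ) < (L : ℝ) ^ (k + 1) := by positivity
  have h1 := norm_smoothLift_le (n := n) hM2 hd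
    (extDir N ((solveW hL k hWu hx hs hWx N hθ (resSkew N hφ) : ↥(skewSub d n N)) : TDir d n N)) y μ
  have h2 := norm_solve_le hL k hWu hx hs hWx N hθ hφ hs0 hφs (blk (L ^ (k + 1)) y) μ
  rw [norm_covLift_eq hWu, liftC]
  rw [hMr] at h1
  have hc : 0 ≤ 24 * (8 : ℝ) ^ (d - 1) / (L : ℝ) ^ (k + 1) := by positivity
  refine h1.trans ((mul_le_mul_of_nonneg_left h2 hc).trans (le_of_eq ?_))
  field_simp

include hθl in
/-- **(R1) ℓ²**: `dirSq (covLift M W Φ) (periodBox (N·M)) ≤ (liftC ∕ (1 − θ_loc))²·(M^d∕M²)·dirSq φ (periodBox N)`. [folklore] -/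
theorem covLift_solveW_R1 (hd : 1 ≤ d) :
    dirSq (covLift (L ^ (k + 1)) W (extDir N ((solveW hL k hWu hx hs hWx N hθ (resSkew N hφ) : ↥(skewSub d n N)) : TDir d n N)))
        (periodBox (d := d) (N * L ^ (k + 1)))
      ≤ (liftC d / (1 - thetaLoc d L * (((L : ℝ) ^ (k + 1)) ^ 2 * x))) ^ 2 * (((L : ℝ) ^ (k + 1)) ^ d / ((L : ℝ) ^ (k + 1)) ^ 2)
          * dirSq φ (periodBox (d := d) N) := by
  have hM2 : 2 ≤ L ^ (k + 1) := le_trans hL (Nat.le_self_pow (by omega) L)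
  have hMr : ((L ^ (k + 1) : ℕ) : ℝ) = (L : ℝ) ^ (k + 1) := by push_cast; ring
  have hpos : 0 < 1 - thetaLoc d L * (((L : ℝ) ^ (k + 1)) ^ 2 * x) := by linarith
  have h1 := dirSq_covLift_le hM2 hd hWu N
    (extDir N ((solveW hL k hWu hx hs hWx N hθ (resSkew N hφ) : ↥(skewSub d n N)) : TDir d n N))
  have h2 := dirSq_solve_le hL k hWu hx hs hWx N hθ hθl hφ
  rw [Nat.mul_comm] at h1
  rw [hMr] at h1
  have hc : 0 ≤ liftC d ^ 2 * (((L : ℝ) ^ (k + 1)) ^ d / ((L : ℝ) ^ (k + 1)) ^ 2) := by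
    have := NE3QbarIterCovLiftPrep.liftC_nonneg d; positivity
  refine h1.trans ((mul_le_mul_of_nonneg_left h2 hc).trans (le_of_eq ?_))
  field_simp

include hθl in
/-- **(R4) ℓ¹**: `dirL1 (covLift M W Φ) (periodBox (N·M)) ≤ (liftC ∕ (1 − θ_loc))·(M^d∕M)·dirL1 φ (periodBox N)`. [folklore] -/
theorem covLift_solveW_R4 (hd : 1 ≤ d) :
    dirL1 (covLift (L ^ (k + 1)) W (extDir N ((solveW hL k hWu hx hs hWx N hθ (resSkew N hφ) : ↥(skewSub d n N)) : TDir d n N)))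
        (periodBox (d := d) (N * L ^ (k + 1)))
      ≤ (liftC d / (1 - thetaLoc d L * (((L : ℝ) ^ (k + 1)) ^ 2 * x))) * (((L : ℝ) ^ (k + 1)) ^ d / (L : ℝ) ^ (k + 1))
          * dirL1 φ (periodBox (d := d) N) := by
  have hM2 : 2 ≤ L ^ (k + 1) := le_trans hL (Nat.le_self_pow (by omega) L)
  have hMr : ((L ^ (k + 1) : ℕ) : ℝ) = (L : ℝ) ^ (k + 1) := by push_cast; ring
  have hpos : 0 < 1 - thetaLoc d L * (((L : ℝ) ^ (k + 1)) ^ 2 * x) := by linarith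
  have h1 := dirL1_covLift_le hM2 hd hWu N
    (extDir N ((solveW hL k hWu hx hs hWx N hθ (resSkew N hφ) : ↥(skewSub d n N)) : TDir d n N))
  have h2 := dirL1_solve_le hL k hWu hx hs hWx N hθ hθl hφ
  rw [Nat.mul_comm] at h1
  rw [hMr] at h1
  have hc : 0 ≤ liftC d * (((L : ℝ) ^ (k + 1)) ^ d / (L : ℝ) ^ (k + 1)) := by
    have := NE3QbarIterCovLiftPrep.liftC_nonneg d; positivity
  refine h1.trans ((mul_le_mul_of_nonneg_left h2 hc).trans (le_of_eq ?_))
  field_simp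

end RightInv

end

end Summit.QuantumFields.BalabanUV.T4Continuum.NE3.QbarRightInverseB8
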